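import Mathlib
import HarnessLib
import Summits.HubbardSuperconductivity.HubbardSuperconductivity.Theorems.KLProgrammeC4aTadpoleRepresentationTube
import Summits.HubbardSuperconductivity.HubbardSuperconductivity.Theorems.KLProgrammePerturbedFermiCurveCompChainStruct
import Literature.MathematicalPhysics.QuantumLattice.SchwartzFourierDensity

/-!
# Route `KLProgramme` — crux C4a, the ALIASING TERM of the tadpole representation: exact decomposition `tadpoleCont = Σ tube tadpoles + Σ_{p₀,y} 𝒟·e`
# with ANGLE-FREE errors `e_{p₀,y}` (`‖e‖ ≤ tail`), Fréchet jets of the coefficients `‖Dᵏ_P 𝒟_{p₀}(P, y)‖` summed over `y` `≤ Lᵏ·mass`, and the angular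
# jets of the aliasing term along the Fermi curve by Bell's formula

Cell `gate-hubbard-kl`, lane hubbard-kl-c4a-1 (g5); helper for stub (C) `stub_twoLeg_curvature` of the engine-flow child `KLRegimeEngineV17F2`
(stmt-HubbardSuperconductivity-20437); memo HOME/hubbard-kl-c4a-1/C4A-PLAN.md §12.5 («alias_jets_le»), §16.2 (δ).  The (A)-closer differentiates
`θ ↦ Re tadpoleCont(k_F^K θ)` (`…C4aAvg8Jets`); the tube part goes to the tube tadpole-jet theorem, the aliasing part is handled HERE:

* §1 `aliasErr β μ K Λ Λ′ r p₀ y := L⁻²S_{p₀}(y) − (2π)⁻²∫_{tube} ŝ_{p₀}(e_K q)e^{iq·ỹ}dq` (def; ANGLE-FREE), `norm_aliasErr_le` (`≤ D/(2π)^M·(2/L)^{M−4}·4C₂`,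
  `…C4aSliceTransform.norm_sliceTransform_sub_tubeFourier_le`), and the EXACT decomposition **`tadpoleCont_eq_tubeTadpoles_add_alias`**:
  `tadpoleCont … P = Σ_{p₀}(2π)⁻²∫_{tube} ŝ_{p₀}(e_K q)·tadpoleVertex β W p₀ (P, q)dq + Σ_{p₀}Σ_y 𝒟_{p₀}(P, y)·aliasErr … p₀ y`;
* §2 Fréchet jets in the external momentum: `norm_iteratedFDeriv_planeWave_le` (`‖Dᵏ_P e^{iP·z̃}‖ ≤ (|z̃₀| + |z̃₁|)ᵏ ≤ Lᵏ`: composition of `exp` with the linear form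
  `intForm z̃`, `Literature.…SchwartzFourierDensity`), `norm_iteratedFDeriv_loopCoeffCont_le`, **`sum_norm_iteratedFDeriv_tadpoleCoeff_le`**
  (`Σ_y ‖Dᵏ_P 𝒟_{p₀}(P, y)‖ ≤ Lᵏ·6|β|L⁴·Σ_{σ,τ}2|Λ|⁻⁴Σ_x‖W₄‖` — the tail's `(2/L)^{M−4}` beats any `Lᵏ`, `M` free);
* §3 **`norm_iteratedFDeriv_aliasSum_le`** — for any angle-free family `e` with `‖e_{p₀,y}‖ ≤ τ_{p₀}`: `‖Dᵏ_P Σ_{p₀,y} 𝒟_{p₀}(P,y)e_{p₀,y}‖ ≤ Lᵏ·mass·Σ_{p₀}τ_{p₀}`, and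
  **`abs_iteratedDeriv_aliasSum_comp_le`** — along any `C⁴` curve `γ` (the Fermi-point map, sizes `D₁..D₄` of `…PerturbedFermiCurveTower`) the angular jets
  of `θ ↦ Re Σ 𝒟(γ θ)e` obey Bell's bounds `abs_iteratedDeriv_comp_le_bell` with `M_k = Lᵏ·mass·Στ`.

Calculus + composition; nothing is asserted about the Hubbard model's sizes; nothing asserts superconductivity.
References: BGM 2006 §2.3 (2.17), §2.4 (2.36)–(2.40) [cite: BenfattoGiulianiMastropietro2006]; Boyd 2001 §4.5 Thm 20 [cite: Boyd2001].
-/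

noncomputable section

namespace Summit.HubbardSuperconductivity.HubbardSuperconductivity.Theorems.C4a

set_option linter.dupNamespace false -- summit = problem name (single-conjunct summit), D-0017

open Real Set MeasureTheory Finset
open scoped ContDiff
open Literature.MathematicalPhysics.QuantumLattice Literature.Probability.LatticeModels GrassmannAlgebra
open Summit.HubbardSuperconductivity.HubbardSuperconductivity.Theorems.KLRegimeSplit
open Summit.HubbardSuperconductivity.HubbardSuperconductivity.Theorems.DispersionFlow
open Summit.HubbardSuperconductivity.HubbardSuperconductivity.Theorems.PerturbedFermiCurve

variable {L M : ℕ} [NeZero L] [NeZero M]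

/-! ## §1 The angle-free aliasing errors and the exact decomposition of the continuum tadpole -/

/-- **The aliasing error of the slice transform at position `y`** (ANGLE-FREE: no external momentum enters):
`aliasErr … p₀ y = L⁻²·Σ_{q⃗} ŝ_{p₀}(e_K(p_q⃗))χ_{q⃗}(y) − (2π)⁻²·∫_{tube_r} ŝ_{p₀}(e_K q)·e^{i Σ_i ỹ_i q_i} dq`. -/
def aliasErr (β μ : ℝ) (K : TrigPolyC4v) (Λ Λ' r : ℝ) (p₀ : MatsubaraIdx M) (y : TorusSite 2 L) : ℂ :=
  ((L : ℂ) ^ 2)⁻¹ * ∑ q : TorusSite 2 L,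
      sliceSymbolFnXi (β * (L : ℝ) ^ 2) 0 Λ Λ' (matsubaraFreq β M p₀) (frameLevel μ K (WithLp.toLp 2 (latticeMomentum L q))) * torusChar q y -
    ((2 * π) ^ 2)⁻¹ • ∫ p in {q : ℝ × ℝ | |q.1| < π ∧ |q.2| < π ∧ |frameLevel μ K (WithLp.toLp 2 ![q.1, q.2])| < r},
      sliceSymbolFnXi (β * (L : ℝ) ^ 2) 0 Λ Λ' (matsubaraFreq β M p₀) (frameLevel μ K (WithLp.toLp 2 ![p.1, p.2])) *
        Complex.exp (((∑ i, ((y i).valMinAbs : ℝ) * (WithLp.toLp 2 ![p.1, p.2] : Momentum) i : ℝ) : ℂ) * Complex.I)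

omit [NeZero M] in
/-- **The aliasing error is below the tail** (`β ≠ 0`, `0 < Λ ≤ Λ′ < r`, `‖D^M(ŝ_{p₀}∘e_K∘2π·)‖ ≤ D`, `M ≥ 4`):
`‖aliasErr … p₀ y‖ ≤ D/(2π)^M·(2/L)^{M−4}·4C₂`, uniformly in `y`. [cite: Boyd2001, §4.5 Theorem 20 (4.47)] -/
theorem norm_aliasErr_le {β : ℝ} (hβ : β ≠ 0) (μ : ℝ) (K : TrigPolyC4v) {Λ Λ' r : ℝ} (hΛ : 0 < Λ) (hΛΛ' : Λ ≤ Λ') (hr : Λ' < r)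
    (p₀ : MatsubaraIdx M) {Mdeg : ℕ} (hM : 4 ≤ Mdeg) {D : ℝ}
    (hD : ∀ y : Momentum, ‖iteratedFDeriv ℝ Mdeg (fun y : Momentum =>
      sliceSymbolFnXi (β * (L : ℝ) ^ 2) 0 Λ Λ' (matsubaraFreq β M p₀) (frameLevel μ K ((2 * π) • y))) y‖ ≤ D) (y : TorusSite 2 L) :
    ‖aliasErr β μ K Λ Λ' r p₀ y‖ ≤ D / (2 * Real.pi) ^ Mdeg * (2 / (L : ℝ)) ^ (Mdeg - 4) * (4 * ∑' k : Fin 2 → ℤ, ∏ j, (1 + (k j : ℝ) ^ 2)⁻¹) :=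
  norm_sliceTransform_sub_tubeFourier_le μ K (sliceSymbolFnXi_matsubara_contDiff hβ L M p₀ Λ Λ')
    (sliceSymbolFnXi_matsubara_tsupport_subset L M p₀ hΛ hΛΛ' hr) hM hD y

/-- The tube tadpole of the representation's vertex is the coefficient-weighted sum of the tube Fourier integrals (finite sum out of the integral). -/
theorem tubeIntegral_tadpoleVertex_eq_sum {β : ℝ} (hβ : β ≠ 0) (μ : ℝ) (K : TrigPolyC4v) (Λ Λ' r : ℝ) (W : HubbardGrassmann L M)
    (p₀ : MatsubaraIdx M) (P : Fin 2 → ℝ) :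
    ∫ p in {q : ℝ × ℝ | |q.1| < π ∧ |q.2| < π ∧ |frameLevel μ K (WithLp.toLp 2 ![q.1, q.2])| < r},
        sliceSymbolFnXi (β * (L : ℝ) ^ 2) 0 Λ Λ' (matsubaraFreq β M p₀) (frameLevel μ K (WithLp.toLp 2 ![p.1, p.2])) *
          tadpoleVertex β W p₀ (WithLp.toLp 2 P) (WithLp.toLp 2 ![p.1, p.2]) =
      ∑ y : TorusSite 2 L, tadpoleCoeff β W p₀ P y *
        ∫ p in {q : ℝ × ℝ | |q.1| < π ∧ |q.2| < π ∧ |frameLevel μ K (WithLp.toLp 2 ![q.1, q.2])| < r},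
          sliceSymbolFnXi (β * (L : ℝ) ^ 2) 0 Λ Λ' (matsubaraFreq β M p₀) (frameLevel μ K (WithLp.toLp 2 ![p.1, p.2])) *
            Complex.exp (((∑ i, ((y i).valMinAbs : ℝ) * (WithLp.toLp 2 ![p.1, p.2] : Momentum) i : ℝ) : ℂ) * Complex.I) := by
  have hint : ∀ y : TorusSite 2 L, IntegrableOn (fun p : ℝ × ℝ =>
      sliceSymbolFnXi (β * (L : ℝ) ^ 2) 0 Λ Λ' (matsubaraFreq β M p₀) (frameLevel μ K (WithLp.toLp 2 ![p.1, p.2])) *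
        Complex.exp (((∑ i, ((y i).valMinAbs : ℝ) * (WithLp.toLp 2 ![p.1, p.2] : Momentum) i : ℝ) : ℂ) * Complex.I))
      {q : ℝ × ℝ | |q.1| < π ∧ |q.2| < π ∧ |frameLevel μ K (WithLp.toLp 2 ![q.1, q.2])| < r} :=
    fun y => integrableOn_tube_levelPlaneWave μ K r (sliceSymbolFnXi_matsubara_contDiff hβ L M p₀ Λ Λ').continuous (fun i => (y i).valMinAbs)
  simp_rw [tadpoleVertex_apply_toLp]
  have hre : ∀ p : ℝ × ℝ, sliceSymbolFnXi (β * (L : ℝ) ^ 2) 0 Λ Λ' (matsubaraFreq β M p₀) (frameLevel μ K (WithLp.toLp 2 ![p.1, p.2])) *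
      ∑ y : TorusSite 2 L, tadpoleCoeff β W p₀ P y *
        Complex.exp (((∑ i, ((y i).valMinAbs : ℝ) * (WithLp.toLp 2 ![p.1, p.2] : Momentum) i : ℝ) : ℂ) * Complex.I) =
      ∑ y : TorusSite 2 L, tadpoleCoeff β W p₀ P y *
        (sliceSymbolFnXi (β * (L : ℝ) ^ 2) 0 Λ Λ' (matsubaraFreq β M p₀) (frameLevel μ K (WithLp.toLp 2 ![p.1, p.2])) *
          Complex.exp (((∑ i, ((y i).valMinAbs : ℝ) * (WithLp.toLp 2 ![p.1, p.2] : Momentum) i : ℝ) : ℂ) * Complex.I)) := by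
    intro p
    rw [Finset.mul_sum]
    exact Finset.sum_congr rfl fun y _ => by ring
  simp_rw [hre]
  rw [integral_finsetSum _ fun y _ => (hint y).const_mul _]
  exact Finset.sum_congr rfl fun y _ => integral_const_mul _ _

/-- **EXACT DECOMPOSITION OF THE CONTINUUM TADPOLE** (`β ≠ 0`): at every external momentum `P`,
`tadpoleCont … P = Σ_{p₀} (2π)⁻²∫_{tube} ŝ_{p₀}(e_K q)·tadpoleVertex β W p₀ (P, q) dq + Σ_{p₀} Σ_y 𝒟_{p₀}(P, y)·aliasErr … p₀ y` — the `P`-dependence of the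
aliasing term sits ENTIRELY in the coefficients `𝒟_{p₀}(P, y)`. [cite: BenfattoGiulianiMastropietro2006, §2.3 (2.17)] -/
theorem tadpoleCont_eq_tubeTadpoles_add_alias {β : ℝ} (hβ : β ≠ 0) (μ : ℝ) (K : TrigPolyC4v) (Λ Λ' r : ℝ) (W : HubbardGrassmann L M)
    (P : Fin 2 → ℝ) :
    tadpoleCont β μ K Λ Λ' W P =
      (∑ p₀ : MatsubaraIdx M, ((2 * π) ^ 2)⁻¹ • ∫ p in {q : ℝ × ℝ | |q.1| < π ∧ |q.2| < π ∧ |frameLevel μ K (WithLp.toLp 2 ![q.1, q.2])| < r},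
          sliceSymbolFnXi (β * (L : ℝ) ^ 2) 0 Λ Λ' (matsubaraFreq β M p₀) (frameLevel μ K (WithLp.toLp 2 ![p.1, p.2])) *
            tadpoleVertex β W p₀ (WithLp.toLp 2 P) (WithLp.toLp 2 ![p.1, p.2])) +
        ∑ p₀ : MatsubaraIdx M, ∑ y : TorusSite 2 L, tadpoleCoeff β W p₀ P y * aliasErr β μ K Λ Λ' r p₀ y := by
  unfold tadpoleCont
  rw [← Finset.sum_add_distrib]
  refine Finset.sum_congr rfl fun p₀ _ => ?_
  rw [tubeIntegral_tadpoleVertex_eq_sum hβ, Finset.smul_sum, ← Finset.sum_add_distrib]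
  refine Finset.sum_congr rfl fun y _ => ?_
  unfold aliasErr
  rw [mul_sub, Complex.real_smul, Complex.real_smul]
  ring

/-! ## §2 Fréchet jets of the coefficients in the external momentum -/

omit [NeZero L] in
/-- All real-Fréchet derivatives of `Complex.exp` at `w` have operator norm `exp (Re w)`. -/
private theorem norm_iteratedFDeriv_cexp' (i : ℕ) (w : ℂ) : ‖iteratedFDeriv ℝ i Complex.exp w‖ = Real.exp w.re := by
  have h := (Complex.contDiff_exp (𝕜 := ℂ) (n := i)).contDiffAt (x := w)
  rw [← h.restrictScalars_iteratedFDeriv (𝕜 := ℝ), Function.comp_apply, ContinuousMultilinearMap.norm_restrictScalars,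
    norm_iteratedFDeriv_eq_norm_iteratedDeriv, iteratedDeriv_eq_iterate, Complex.iter_deriv_exp, Complex.norm_exp]

omit [NeZero L] in
/-- The plane wave with centred frequency `z̃` is `exp` composed with the real-linear map `P ↦ (z̃·P)·i`. -/
theorem planeWave_eq_cexp_comp (z : TorusSite 2 L) :
    (fun P : Momentum => Complex.exp (((∑ j, (WithLp.ofLp P) j * ((z j).valMinAbs : ℝ) : ℝ) : ℂ) * Complex.I)) =
      Complex.exp ∘ ⇑((intForm (ι := Fin 2) (fun j => (z j).valMinAbs)).smulRight Complex.I) := by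
  funext P
  simp only [Function.comp_apply, ContinuousLinearMap.smulRight_apply, intForm_apply, Complex.real_smul]
  rw [show (∑ j, (WithLp.ofLp P) j * (((z j).valMinAbs : ℤ) : ℝ)) = ∑ c, (((z c).valMinAbs : ℤ) : ℝ) * P c from
    Finset.sum_congr rfl fun j _ => mul_comm _ _]

/-- The `ℓ¹` size of a centred frequency is at most `L` (`2|z̃_j| ≤ L` for both coordinates). -/
theorem absSum_valMinAbs_le (z : TorusSite 2 L) : absSum (fun j => (z j).valMinAbs) ≤ (L : ℝ) := by
  unfold absSum
  rw [Fin.sum_univ_two]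
  have h0 := two_mul_abs_valMinAbs_le z 0
  have h1 := two_mul_abs_valMinAbs_le z 1
  have h0' : 2 * |(((z 0).valMinAbs : ℤ) : ℝ)| ≤ (L : ℝ) := by rw [← Int.cast_abs]; exact_mod_cast h0
  have h1' : 2 * |(((z 1).valMinAbs : ℤ) : ℝ)| ≤ (L : ℝ) := by rw [← Int.cast_abs]; exact_mod_cast h1
  linarith

omit [NeZero L] in
/-- The plane wave is smooth in the external momentum. -/
theorem contDiff_planeWave (z : TorusSite 2 L) {N : ℕ∞} :
    ContDiff ℝ N fun P : Momentum => Complex.exp (((∑ j, (WithLp.ofLp P) j * ((z j).valMinAbs : ℝ) : ℝ) : ℂ) * Complex.I) := by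
  rw [planeWave_eq_cexp_comp]
  exact Complex.contDiff_exp.comp (ContinuousLinearMap.contDiff _)

/-- **Fréchet jets of a plane wave**: `‖Dᵏ_P e^{i Σ_j P_j z̃_j}‖ ≤ Lᵏ`. [cite: BenfattoGiulianiMastropietro2006, §2.4 (2.40)] -/
theorem norm_iteratedFDeriv_planeWave_le (z : TorusSite 2 L) (k : ℕ) (P : Momentum) :
    ‖iteratedFDeriv ℝ k (fun P : Momentum => Complex.exp (((∑ j, (WithLp.ofLp P) j * ((z j).valMinAbs : ℝ) : ℝ) : ℂ) * Complex.I)) P‖ ≤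
      (L : ℝ) ^ k := by
  rw [planeWave_eq_cexp_comp, ((intForm (ι := Fin 2) (fun j => (z j).valMinAbs)).smulRight Complex.I).iteratedFDeriv_comp_right
    Complex.contDiff_exp P (i := k) (by exact_mod_cast le_top)]
  refine (ContinuousMultilinearMap.norm_compContinuousLinearMap_le _ _).trans ?_
  rw [norm_iteratedFDeriv_cexp', Finset.prod_const, Finset.card_univ, Fintype.card_fin]
  have hre : (((intForm (ι := Fin 2) (fun j => (z j).valMinAbs)).smulRight Complex.I) P).re = 0 := by
    simp [ContinuousLinearMap.smulRight_apply, Complex.real_smul]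
  rw [hre, Real.exp_zero, one_mul]
  refine pow_le_pow_left₀ (norm_nonneg _) ?_ k
  rw [ContinuousLinearMap.norm_smulRight_apply, Complex.norm_I, mul_one]
  exact (norm_intForm_le _).trans (absSum_valMinAbs_le z)

/-- Fréchet jets of a constant multiple of a plane wave: `‖Dᵏ_P [a·e^{iP·z̃}]‖ ≤ ‖a‖·Lᵏ`. -/
theorem norm_iteratedFDeriv_const_mul_planeWave_le (a : ℂ) (z : TorusSite 2 L) (k : ℕ) (P : Momentum) :
    ‖iteratedFDeriv ℝ k (fun P : Momentum => a * Complex.exp (((∑ j, (WithLp.ofLp P) j * ((z j).valMinAbs : ℝ) : ℝ) : ℂ) * Complex.I)) P‖ ≤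
      ‖a‖ * (L : ℝ) ^ k := by
  have h : (fun P : Momentum => a * Complex.exp (((∑ j, (WithLp.ofLp P) j * ((z j).valMinAbs : ℝ) : ℝ) : ℂ) * Complex.I)) =
      fun P => a • Complex.exp (((∑ j, (WithLp.ofLp P) j * ((z j).valMinAbs : ℝ) : ℝ) : ℂ) * Complex.I) := rfl
  rw [h, iteratedFDeriv_const_smul_apply' ((contDiff_planeWave z (N := k)).contDiffAt), norm_smul]
  exact mul_le_mul_of_nonneg_left (norm_iteratedFDeriv_planeWave_le z k P) (norm_nonneg _)

/-! ### The loop coefficient and the tadpole coefficient as functions of the external momentum -/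

omit [NeZero M] in
/-- The continuum loop coefficient, read on `Momentum`, as a constant multiple of a sum of (constant × plane wave). -/
theorem loopCoeffCont_ofLp_eq (β : ℝ) (W : HubbardGrassmann L M) (κ p₀ : MatsubaraIdx M) (σ τ : Fin 2) (y : TorusSite 2 L) :
    (fun P : Momentum => loopCoeffCont β W κ p₀ σ τ (WithLp.ofLp P) y) = fun P : Momentum =>
      (((Fintype.card (SpaceTimeIdx L M) : ℂ) ^ 4)⁻¹ •
        ∑ x ∈ (Finset.univ : Finset (Fin 4 → SpaceTimeIdx L M)).filter (fun x => (x 3).2 - (x 2).2 = y),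
          (positionKernel L M β W 4 (fun i => ((x i, ![σ, σ, τ, τ] i), (![0, 1, 1, 0] : Fin 4 → Fin 2) i)) *
              (Complex.exp (((matsubaraFreq β M κ * (imagTime β M (x 0).1 - imagTime β M (x 1).1) : ℝ) : ℂ) * Complex.I) *
                Complex.exp (((matsubaraFreq β M p₀ * (imagTime β M (x 3).1 - imagTime β M (x 2).1) : ℝ) : ℂ) * Complex.I))) *
            Complex.exp (((∑ j, (WithLp.ofLp P) j * ((((x 0).2 - (x 1).2) j).valMinAbs : ℝ) : ℝ) : ℂ) * Complex.I)) := by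
  funext P
  unfold loopCoeffCont
  rw [smul_eq_mul]
  congr 1
  exact Finset.sum_congr rfl fun x _ => by ring

omit [NeZero M] in
/-- The loop coefficient is `C^∞` in the external momentum. -/
theorem contDiff_loopCoeffCont_ofLp (β : ℝ) (W : HubbardGrassmann L M) (κ p₀ : MatsubaraIdx M) (σ τ : Fin 2) (y : TorusSite 2 L) {N : ℕ∞} :
    ContDiff ℝ N fun P : Momentum => loopCoeffCont β W κ p₀ σ τ (WithLp.ofLp P) y := by
  rw [loopCoeffCont_ofLp_eq]
  exact (ContDiff.sum fun x _ => contDiff_const.mul (contDiff_planeWave _)).const_smul _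

/-- **Fréchet jets of the loop coefficient**: `‖Dᵏ_P loopCoeffCont(P, y)‖ ≤ |Λ|⁻⁴·(Σ_{x : x⃗₃−x⃗₂ = y} ‖W₄(x)‖)·Lᵏ`.
[cite: BenfattoGiulianiMastropietro2006, §2.4 (2.40)] -/
theorem norm_iteratedFDeriv_loopCoeffCont_le (β : ℝ) (W : HubbardGrassmann L M) (κ p₀ : MatsubaraIdx M) (σ τ : Fin 2) (y : TorusSite 2 L)
    (k : ℕ) (P : Momentum) :
    ‖iteratedFDeriv ℝ k (fun P : Momentum => loopCoeffCont β W κ p₀ σ τ (WithLp.ofLp P) y) P‖ ≤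
      ((Fintype.card (SpaceTimeIdx L M) : ℝ) ^ 4)⁻¹ *
        (∑ x ∈ (Finset.univ : Finset (Fin 4 → SpaceTimeIdx L M)).filter (fun x => (x 3).2 - (x 2).2 = y),
          ‖positionKernel L M β W 4 (fun i => ((x i, ![σ, σ, τ, τ] i), (![0, 1, 1, 0] : Fin 4 → Fin 2) i))‖) * (L : ℝ) ^ k := by
  have hterm : ∀ x : Fin 4 → SpaceTimeIdx L M, ContDiff ℝ k fun P : Momentum =>
      (positionKernel L M β W 4 (fun i => ((x i, ![σ, σ, τ, τ] i), (![0, 1, 1, 0] : Fin 4 → Fin 2) i)) *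
          (Complex.exp (((matsubaraFreq β M κ * (imagTime β M (x 0).1 - imagTime β M (x 1).1) : ℝ) : ℂ) * Complex.I) *
            Complex.exp (((matsubaraFreq β M p₀ * (imagTime β M (x 3).1 - imagTime β M (x 2).1) : ℝ) : ℂ) * Complex.I))) *
        Complex.exp (((∑ j, (WithLp.ofLp P) j * ((((x 0).2 - (x 1).2) j).valMinAbs : ℝ) : ℝ) : ℂ) * Complex.I) :=
    fun x => contDiff_const.mul (contDiff_planeWave _)
  have hunit : ∀ x : Fin 4 → SpaceTimeIdx L M,
      ‖Complex.exp (((matsubaraFreq β M κ * (imagTime β M (x 0).1 - imagTime β M (x 1).1) : ℝ) : ℂ) * Complex.I) *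
          Complex.exp (((matsubaraFreq β M p₀ * (imagTime β M (x 3).1 - imagTime β M (x 2).1) : ℝ) : ℂ) * Complex.I)‖ = 1 := by
    intro x
    rw [norm_mul, Complex.norm_exp_ofReal_mul_I, Complex.norm_exp_ofReal_mul_I, mul_one]
  rw [loopCoeffCont_ofLp_eq, iteratedFDeriv_const_smul_apply' ((ContDiff.sum fun x _ => hterm x).contDiffAt),
    norm_smul, norm_inv, norm_pow, Complex.norm_natCast, iteratedFDeriv_fun_sum_apply fun x _ => (hterm x).contDiffAt, mul_assoc]
  refine mul_le_mul_of_nonneg_left ?_ (by positivity)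
  rw [Finset.sum_mul]
  refine (norm_sum_le _ _).trans (Finset.sum_le_sum fun x _ => ?_)
  refine (norm_iteratedFDeriv_const_mul_planeWave_le _ _ k P).trans (le_of_eq ?_)
  rw [norm_mul, hunit, mul_one]

/-- **Fréchet jets of the loop coefficients, summed over the loop position**: `Σ_y ‖Dᵏ_P loopCoeffCont(P, y)‖ ≤ |Λ|⁻⁴·Σ_x‖W₄(x)‖·Lᵏ`. -/
theorem sum_norm_iteratedFDeriv_loopCoeffCont_le (β : ℝ) (W : HubbardGrassmann L M) (κ p₀ : MatsubaraIdx M) (σ τ : Fin 2) (k : ℕ) (P : Momentum) :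
    ∑ y : TorusSite 2 L, ‖iteratedFDeriv ℝ k (fun P : Momentum => loopCoeffCont β W κ p₀ σ τ (WithLp.ofLp P) y) P‖ ≤
      ((Fintype.card (SpaceTimeIdx L M) : ℝ) ^ 4)⁻¹ *
        (∑ x : Fin 4 → SpaceTimeIdx L M, ‖positionKernel L M β W 4 (fun i => ((x i, ![σ, σ, τ, τ] i), (![0, 1, 1, 0] : Fin 4 → Fin 2) i))‖) *
          (L : ℝ) ^ k := by
  refine (Finset.sum_le_sum fun y _ => norm_iteratedFDeriv_loopCoeffCont_le β W κ p₀ σ τ y k P).trans (le_of_eq ?_)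
  rw [← Finset.sum_mul, ← Finset.mul_sum, Finset.sum_fiberwise Finset.univ (fun x : Fin 4 → SpaceTimeIdx L M => (x 3).2 - (x 2).2)]

/-- The tadpole coefficient is `C^∞` in the external momentum. -/
theorem contDiff_tadpoleCoeff_ofLp (β : ℝ) (W : HubbardGrassmann L M) (p₀ : MatsubaraIdx M) (y : TorusSite 2 L) {N : ℕ∞} :
    ContDiff ℝ N fun P : Momentum => tadpoleCoeff β W p₀ (WithLp.ofLp P) y := by
  unfold tadpoleCoeff
  exact contDiff_const.mul (ContDiff.sum fun σ _ => ContDiff.sum fun τ _ => ContDiff.sum fun κ _ => contDiff_loopCoeffCont_ofLp β W _ p₀ σ τ y)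

/-- **Fréchet jets of the tadpole coefficients, summed over the loop position**:
`Σ_y ‖Dᵏ_P 𝒟_{p₀}(P, y)‖ ≤ Lᵏ·6|β|L⁴·Σ_{σ,τ} 2·|Λ|⁻⁴Σ_x‖W₄^{σ,τ}(x)‖` (the coefficient mass of `sum_norm_tadpoleCoeff_le` times `Lᵏ`).
[cite: BenfattoGiulianiMastropietro2006, §2.4 (2.40)] -/
theorem sum_norm_iteratedFDeriv_tadpoleCoeff_le (β : ℝ) (W : HubbardGrassmann L M) (p₀ : MatsubaraIdx M) (k : ℕ) (P : Momentum) :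
    ∑ y : TorusSite 2 L, ‖iteratedFDeriv ℝ k (fun P : Momentum => tadpoleCoeff β W p₀ (WithLp.ofLp P) y) P‖ ≤
      (L : ℝ) ^ k * (6 * |β| * (L : ℝ) ^ 4 * ∑ σ : Fin 2, ∑ τ : Fin 2, 2 * (((Fintype.card (SpaceTimeIdx L M) : ℝ) ^ 4)⁻¹ *
        ∑ x : Fin 4 → SpaceTimeIdx L M, ‖positionKernel L M β W 4 (fun i => ((x i, ![σ, σ, τ, τ] i), (![0, 1, 1, 0] : Fin 4 → Fin 2) i))‖)) := by
  have hK : ‖((6 * β * (L : ℝ) ^ 4 : ℝ) : ℂ)‖ = 6 * |β| * (L : ℝ) ^ 4 := by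
    rw [Complex.norm_real, Real.norm_eq_abs, abs_mul, abs_mul, abs_of_nonneg (by norm_num : (0 : ℝ) ≤ 6),
      abs_of_nonneg (by positivity : (0 : ℝ) ≤ (L : ℝ) ^ 4)]
  -- per position: constant multiple of a triple sum of smooth functions
  have hy : ∀ y : TorusSite 2 L, ‖iteratedFDeriv ℝ k (fun P : Momentum => tadpoleCoeff β W p₀ (WithLp.ofLp P) y) P‖ ≤
      6 * |β| * (L : ℝ) ^ 4 * ∑ σ : Fin 2, ∑ τ : Fin 2, ∑ κ : Fin 2,
        ‖iteratedFDeriv ℝ k (fun P : Momentum =>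
          loopCoeffCont β W ((![omega0 M, (omega0 M).rev] : Fin 2 → MatsubaraIdx M) κ) p₀ σ τ (WithLp.ofLp P) y) P‖ := by
    intro y
    have hfun : (fun P : Momentum => tadpoleCoeff β W p₀ (WithLp.ofLp P) y) = fun P : Momentum => ((6 * β * (L : ℝ) ^ 4 : ℝ) : ℂ) •
        ∑ σ : Fin 2, ∑ τ : Fin 2, ∑ κ : Fin 2,
          loopCoeffCont β W ((![omega0 M, (omega0 M).rev] : Fin 2 → MatsubaraIdx M) κ) p₀ σ τ (WithLp.ofLp P) y := by
      funext P; rfl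
    have hs : ∀ σ τ κ, ContDiff ℝ k fun P : Momentum =>
        loopCoeffCont β W ((![omega0 M, (omega0 M).rev] : Fin 2 → MatsubaraIdx M) κ) p₀ σ τ (WithLp.ofLp P) y :=
      fun σ τ κ => contDiff_loopCoeffCont_ofLp β W _ p₀ σ τ y
    have hsum : ContDiff ℝ k fun P : Momentum => ∑ σ : Fin 2, ∑ τ : Fin 2, ∑ κ : Fin 2,
        loopCoeffCont β W ((![omega0 M, (omega0 M).rev] : Fin 2 → MatsubaraIdx M) κ) p₀ σ τ (WithLp.ofLp P) y :=
      ContDiff.sum fun σ _ => ContDiff.sum fun τ _ => ContDiff.sum fun κ _ => hs σ τ κ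
    rw [hfun, iteratedFDeriv_const_smul_apply' hsum.contDiffAt, norm_smul, hK]
    refine mul_le_mul_of_nonneg_left ?_ (by positivity)
    rw [iteratedFDeriv_fun_sum_apply fun σ _ => (ContDiff.sum fun τ _ => ContDiff.sum fun κ _ => hs σ τ κ).contDiffAt]
    refine (norm_sum_le _ _).trans (Finset.sum_le_sum fun σ _ => ?_)
    rw [iteratedFDeriv_fun_sum_apply fun τ _ => (ContDiff.sum fun κ _ => hs σ τ κ).contDiffAt]
    refine (norm_sum_le _ _).trans (Finset.sum_le_sum fun τ _ => ?_)
    rw [iteratedFDeriv_fun_sum_apply fun κ _ => (hs σ τ κ).contDiffAt]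
    exact norm_sum_le _ _
  calc ∑ y : TorusSite 2 L, ‖iteratedFDeriv ℝ k (fun P : Momentum => tadpoleCoeff β W p₀ (WithLp.ofLp P) y) P‖
      ≤ ∑ y : TorusSite 2 L, 6 * |β| * (L : ℝ) ^ 4 * ∑ σ : Fin 2, ∑ τ : Fin 2, ∑ κ : Fin 2,
          ‖iteratedFDeriv ℝ k (fun P : Momentum =>
            loopCoeffCont β W ((![omega0 M, (omega0 M).rev] : Fin 2 → MatsubaraIdx M) κ) p₀ σ τ (WithLp.ofLp P) y) P‖ :=
        Finset.sum_le_sum fun y _ => hy y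
    _ = 6 * |β| * (L : ℝ) ^ 4 * ∑ σ : Fin 2, ∑ τ : Fin 2, ∑ κ : Fin 2, ∑ y : TorusSite 2 L,
          ‖iteratedFDeriv ℝ k (fun P : Momentum =>
            loopCoeffCont β W ((![omega0 M, (omega0 M).rev] : Fin 2 → MatsubaraIdx M) κ) p₀ σ τ (WithLp.ofLp P) y) P‖ := by
        rw [← Finset.mul_sum, Finset.sum_comm]
        congr 1
        refine Finset.sum_congr rfl fun σ _ => ?_
        rw [Finset.sum_comm]
        refine Finset.sum_congr rfl fun τ _ => ?_
        rw [Finset.sum_comm]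
    _ ≤ 6 * |β| * (L : ℝ) ^ 4 * ((∑ σ : Fin 2, ∑ τ : Fin 2, 2 * (((Fintype.card (SpaceTimeIdx L M) : ℝ) ^ 4)⁻¹ *
          ∑ x : Fin 4 → SpaceTimeIdx L M, ‖positionKernel L M β W 4 (fun i => ((x i, ![σ, σ, τ, τ] i), (![0, 1, 1, 0] : Fin 4 → Fin 2) i))‖)) *
            (L : ℝ) ^ k) := by
        refine mul_le_mul_of_nonneg_left ?_ (by positivity)
        rw [Finset.sum_mul]
        refine Finset.sum_le_sum fun σ _ => ?_
        rw [Finset.sum_mul]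
        refine Finset.sum_le_sum fun τ _ => ?_
        simp only [Fin.sum_univ_two, Matrix.cons_val_zero, Matrix.cons_val_one]
        have h0 := sum_norm_iteratedFDeriv_loopCoeffCont_le β W (omega0 M) p₀ σ τ k P
        have h1 := sum_norm_iteratedFDeriv_loopCoeffCont_le β W (omega0 M).rev p₀ σ τ k P
        linarith
    _ = _ := by ring

/-! ## §3 The aliasing sum: Fréchet jets and angular jets along a curve -/

/-- The aliasing sum `P ↦ Σ_{p₀} Σ_y 𝒟_{p₀}(P, y)·e_{p₀,y}` is `C^∞` in the external momentum (for any angle-free family `e`). -/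
theorem contDiff_aliasSum (β : ℝ) (W : HubbardGrassmann L M) (e : MatsubaraIdx M → TorusSite 2 L → ℂ) {N : ℕ∞} :
    ContDiff ℝ N fun P : Momentum => ∑ p₀ : MatsubaraIdx M, ∑ y : TorusSite 2 L, tadpoleCoeff β W p₀ (WithLp.ofLp P) y * e p₀ y :=
  ContDiff.sum fun p₀ _ => ContDiff.sum fun y _ => (contDiff_tadpoleCoeff_ofLp β W p₀ y).mul contDiff_const

/-- **Fréchet jets of the aliasing sum**: for an angle-free family with `‖e_{p₀,y}‖ ≤ τ_{p₀}`,
`‖Dᵏ_P Σ_{p₀,y} 𝒟_{p₀}(P, y)·e_{p₀,y}‖ ≤ Lᵏ·mass·Σ_{p₀} τ_{p₀}`. [cite: BenfattoGiulianiMastropietro2006, §2.4 (2.40)] -/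
theorem norm_iteratedFDeriv_aliasSum_le (β : ℝ) (W : HubbardGrassmann L M) {e : MatsubaraIdx M → TorusSite 2 L → ℂ} {τ : MatsubaraIdx M → ℝ}
    (he : ∀ p₀ y, ‖e p₀ y‖ ≤ τ p₀) (k : ℕ) (P : Momentum) :
    ‖iteratedFDeriv ℝ k (fun P : Momentum => ∑ p₀ : MatsubaraIdx M, ∑ y : TorusSite 2 L, tadpoleCoeff β W p₀ (WithLp.ofLp P) y * e p₀ y) P‖ ≤
      (L : ℝ) ^ k * (6 * |β| * (L : ℝ) ^ 4 * ∑ σ : Fin 2, ∑ τ : Fin 2, 2 * (((Fintype.card (SpaceTimeIdx L M) : ℝ) ^ 4)⁻¹ *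
        ∑ x : Fin 4 → SpaceTimeIdx L M, ‖positionKernel L M β W 4 (fun i => ((x i, ![σ, σ, τ, τ] i), (![0, 1, 1, 0] : Fin 4 → Fin 2) i))‖)) *
          ∑ p₀ : MatsubaraIdx M, τ p₀ := by
  have hτ : ∀ p₀, 0 ≤ τ p₀ := fun p₀ => (norm_nonneg _).trans (he p₀ 0)
  have hterm : ∀ p₀ y, ContDiff ℝ k fun P : Momentum => tadpoleCoeff β W p₀ (WithLp.ofLp P) y * e p₀ y :=
    fun p₀ y => (contDiff_tadpoleCoeff_ofLp β W p₀ y).mul contDiff_const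
  have hmul : ∀ p₀ y, ‖iteratedFDeriv ℝ k (fun P : Momentum => tadpoleCoeff β W p₀ (WithLp.ofLp P) y * e p₀ y) P‖ =
      ‖iteratedFDeriv ℝ k (fun P : Momentum => tadpoleCoeff β W p₀ (WithLp.ofLp P) y) P‖ * ‖e p₀ y‖ := by
    intro p₀ y
    have hfun : (fun P : Momentum => tadpoleCoeff β W p₀ (WithLp.ofLp P) y * e p₀ y) =
        fun P : Momentum => e p₀ y • tadpoleCoeff β W p₀ (WithLp.ofLp P) y := by
      funext P; rw [smul_eq_mul, mul_comm]
    rw [hfun, iteratedFDeriv_const_smul_apply' (contDiff_tadpoleCoeff_ofLp β W p₀ y (N := k)).contDiffAt, norm_smul, mul_comm]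
  rw [iteratedFDeriv_fun_sum_apply fun p₀ _ => (ContDiff.sum fun y _ => hterm p₀ y).contDiffAt]
  refine (norm_sum_le _ _).trans ?_
  rw [Finset.mul_sum]
  refine Finset.sum_le_sum fun p₀ _ => ?_
  rw [iteratedFDeriv_fun_sum_apply fun y _ => (hterm p₀ y).contDiffAt]
  refine (norm_sum_le _ _).trans ?_
  calc ∑ y : TorusSite 2 L, ‖iteratedFDeriv ℝ k (fun P : Momentum => tadpoleCoeff β W p₀ (WithLp.ofLp P) y * e p₀ y) P‖
      ≤ ∑ y : TorusSite 2 L, ‖iteratedFDeriv ℝ k (fun P : Momentum => tadpoleCoeff β W p₀ (WithLp.ofLp P) y) P‖ * τ p₀ := by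
        refine Finset.sum_le_sum fun y _ => ?_
        rw [hmul]
        exact mul_le_mul_of_nonneg_left (he p₀ y) (norm_nonneg _)
    _ ≤ _ := by
        rw [← Finset.sum_mul]
        exact mul_le_mul_of_nonneg_right (sum_norm_iteratedFDeriv_tadpoleCoeff_le β W p₀ k P) (hτ p₀)

/-- **ANGULAR JETS OF THE ALIASING TERM ALONG A CURVE (Bell's formula).**  For any `C⁴` curve `γ : ℝ → Momentum` with `‖γ⁽ⁱ⁾(θ)‖ ≤ D_i` (`1 ≤ i ≤ 4`; the
Fermi-point map of `…PerturbedFermiCurveTower`) and any angle-free family with `‖e_{p₀,y}‖ ≤ τ_{p₀}`: with `M_k := Lᵏ·mass·Σ_{p₀}τ_{p₀}`, the function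
`A(θ) = Re Σ_{p₀,y} 𝒟_{p₀}(γ θ, y)·e_{p₀,y}` satisfies `|A′| ≤ M₁D₁`, `|A″| ≤ M₂D₁² + M₁D₂`, `|A‴| ≤ M₃D₁³ + 3M₂D₁D₂ + M₁D₃`,
`|A⁗| ≤ M₄D₁⁴ + 6M₃D₁²D₂ + 3M₂D₂² + 4M₂D₁D₃ + M₁D₄`. [cite: BenfattoGiulianiMastropietro2006, §2.4 (2.36)–(2.40)] -/
theorem abs_iteratedDeriv_re_aliasSum_comp_le (β : ℝ) (W : HubbardGrassmann L M) {e : MatsubaraIdx M → TorusSite 2 L → ℂ}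
    {τ : MatsubaraIdx M → ℝ} (he : ∀ p₀ y, ‖e p₀ y‖ ≤ τ p₀) {γ : ℝ → Momentum} (hγ : ContDiff ℝ 4 γ) {θ : ℝ} {D : ℕ → ℝ}
    (hD : ∀ i, 1 ≤ i → i ≤ 4 → ‖iteratedDeriv i γ θ‖ ≤ D i) {Mk : ℕ → ℝ}
    (hMk : ∀ k, Mk k = (L : ℝ) ^ k * (6 * |β| * (L : ℝ) ^ 4 * ∑ σ : Fin 2, ∑ τ : Fin 2, 2 * (((Fintype.card (SpaceTimeIdx L M) : ℝ) ^ 4)⁻¹ *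
        ∑ x : Fin 4 → SpaceTimeIdx L M, ‖positionKernel L M β W 4 (fun i => ((x i, ![σ, σ, τ, τ] i), (![0, 1, 1, 0] : Fin 4 → Fin 2) i))‖)) *
          ∑ p₀ : MatsubaraIdx M, τ p₀) :
    |iteratedDeriv 1 ((fun P : Momentum => (∑ p₀ : MatsubaraIdx M, ∑ y : TorusSite 2 L, tadpoleCoeff β W p₀ (WithLp.ofLp P) y * e p₀ y).re) ∘ γ) θ| ≤
        Mk 1 * D 1 ∧
      |iteratedDeriv 2 ((fun P : Momentum => (∑ p₀ : MatsubaraIdx M, ∑ y : TorusSite 2 L, tadpoleCoeff β W p₀ (WithLp.ofLp P) y * e p₀ y).re) ∘ γ) θ| ≤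
        Mk 2 * D 1 ^ 2 + Mk 1 * D 2 ∧
      |iteratedDeriv 3 ((fun P : Momentum => (∑ p₀ : MatsubaraIdx M, ∑ y : TorusSite 2 L, tadpoleCoeff β W p₀ (WithLp.ofLp P) y * e p₀ y).re) ∘ γ) θ| ≤
        Mk 3 * D 1 ^ 3 + 3 * Mk 2 * D 1 * D 2 + Mk 1 * D 3 ∧
      |iteratedDeriv 4 ((fun P : Momentum => (∑ p₀ : MatsubaraIdx M, ∑ y : TorusSite 2 L, tadpoleCoeff β W p₀ (WithLp.ofLp P) y * e p₀ y).re) ∘ γ) θ| ≤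
        Mk 4 * D 1 ^ 4 + 6 * Mk 3 * D 1 ^ 2 * D 2 + 3 * Mk 2 * D 2 ^ 2 + 4 * Mk 2 * D 1 * D 3 + Mk 1 * D 4 := by
  have hG : ContDiff ℝ 4 (fun P : Momentum => ∑ p₀ : MatsubaraIdx M, ∑ y : TorusSite 2 L, tadpoleCoeff β W p₀ (WithLp.ofLp P) y * e p₀ y) :=
    contDiff_aliasSum β W e
  have hF : ContDiff ℝ 4 (fun P : Momentum => (∑ p₀ : MatsubaraIdx M, ∑ y : TorusSite 2 L, tadpoleCoeff β W p₀ (WithLp.ofLp P) y * e p₀ y).re) :=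
    Complex.reCLM.contDiff.comp hG
  refine abs_iteratedDeriv_comp_le_bell hF hγ (fun k hk1 hk4 => ?_) hD
  have hcomp : (fun P : Momentum => (∑ p₀ : MatsubaraIdx M, ∑ y : TorusSite 2 L, tadpoleCoeff β W p₀ (WithLp.ofLp P) y * e p₀ y).re) =
      ⇑Complex.reCLM ∘ fun P : Momentum => ∑ p₀ : MatsubaraIdx M, ∑ y : TorusSite 2 L, tadpoleCoeff β W p₀ (WithLp.ofLp P) y * e p₀ y := rfl
  rw [hcomp]
  refine (Complex.reCLM.norm_iteratedFDeriv_comp_left (hG.contDiffAt) (by exact_mod_cast hk4)).trans ?_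
  rw [Complex.reCLM_norm, one_mul, hMk]
  exact norm_iteratedFDeriv_aliasSum_le β W he k (γ θ)

end Summit.HubbardSuperconductivity.HubbardSuperconductivity.Theorems.C4a

end
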